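import Summits.QuantumFields.YangMills.Theorems.UnitScaleTiltProp7StubEXOfChartPiecesTwS3SECtrR
import Summits.QuantumFields.YangMills.Theorems.UnitScaleTiltProp7StubEXOfChartPiecesTwS5
import Summits.QuantumFields.YangMills.Theorems.UnitScaleTiltProp7ChartWOfCov
import Summits.QuantumFields.YangMills.Theorems.UnitScaleTiltMinimiserStabilityRegPrPV3EChart
import HarnessLib

/-!
# [CTR TWIN (S7′ design, EX namer ★w2-19200 g6 2026-08-28 21:50Z∕21:52Z (T5), seat ym3-torus-px5 g2): ✓`Prop7StubEXOfChartPiecesTwS5E` BYTE-IDENTICAL except: the displayed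
# `hXtw‴` carries the OPAQUE parallel-section LIFTING antecedent `Lift L i U₀ →` (binder `Lift : ∀ L (i : Idx L), GaugeField … → Prop`, ★px14 (T1)(T2) design; text of record 8467e4121a10a649
# substituted only at the display T7) right after `CloseAvg … V U₀ →`; the SYMMETRIC-CENTRE row `hSymCentre` in the RADIUS-LETTER form of record (HSYMCENTRE-R 51a42dd370cd586d, EX namer RULING 22:08:41Z: `∃ aS CS, … RegPr (CS·ε₁) U₁ ∧ Lift L i U₁`) is displayed and passed through; the one call is re-pointed to the CTR-R twin ✓`stubEX_of_chartPiecesTwS3SECtrR` (★px16 T4-R). Theorem `stubEX_of_chartPiecesTwS5ECtrR` (naming rule 22:16:57Z: files displaying `hSymCentre` take `CtrR`).]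
# [v3.4ˢ″ KNIT CORE = ✓`Prop7StubEXOfChartPiecesTwS5` (v3.2ˢ) WITH CURE (α) — the (45)–(46) operator is a NAMED letter `Hf` with plain rows `h45 h45L h46₀ hHfR` (fourth located lettering defect: the `∀H`
# prefix of the XL row did not pin `H`) — AND THE ε₁-FORM (19)-SIZE `nMax19 U₀ X ≤ M L·(L³·3L·ε₁)` (third defect; print's «ε₂ = O(1)·C₁B₃ε₁» p.299) with the window `hMe : M·α < ef`; the XL row `hXtw‴` is kept here
# at `H := Hf L i U₀` WITHOUT H-antecedents (the display file TwS6E cuts it into `hSize19′`∕`hCrit93′`∕`hSplit′`); everything else VERBATIM; knit lineage 2026-08-28.]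
# [v3.2ˢ = ✓`Prop7StubEXOfChartPiecesTwS4` (v3.1ˢ) WITH THE THEOREM-2 SOCKET IN `Thm2SetupSUAt` CURRENCY — the weakest currency both consumers need (COV ✓`cov_of_thm2SetupSUAt`,
# based binder ✓`thm2Based_of_thm2SetupSUAt`), matching lit-balaban's endpoint ✓`B8Thm2T3FamilyBinder.hThm2_of_constants` (A13); ★★OWNER g27 ACK 55 (1), socket owner's
# word (T-b) 2026-08-28 12:46Z; everything else below VERBATIM.]
# Route `UnitScaleTilt`, crux K1 child «MinimiserStabilityRegPr» (stmt-QuantumFields-19200), skeleton v10, stub `stub_existenceMinimalOrbit` (EX), route (α) — **THE EX KNIT AT THE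
# CHART OF RECORD AND THE SYMMETRIC SLICE, v3.1ˢ: CHART_W PROVED FROM THE KNIT'S OWN THEOREM-2 SOCKET READ AT THE CRITICAL BACKGROUND; THE GROWTH SIDE DISPLAYS ONE ROW IN
# E′'s LETTERS** (knit lineage, 2026-08-28; on top of the knit of record v3.0ˢ ✓`Prop7StubEXOfChartPiecesTwS3`).  The opaque slice `Tsl`, the window `aW` and the two rows
# CHART_W ∕ LOCMIN_W of v3.0ˢ are DISCHARGED: `Tsl L i W :=` the tautological slice {`D` Hermitian-traceless, `A(W) ≤ A(e^{iD}W)`} (LOCMIN_W is its definition), `aW L :=`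
# the seven thresholds of ✓`…PV3EChart.isMinOn_regFibrePr_of_thm2_coercive142_at` and of COV at `W` divided by `178`, and CHART_W is PROVED at the critical background
# `W = (e^{iX}U₀)^u ∈ (6)(178ε₄) ∩ 𝔅_k(V)` from (a) `W` MINIMISES over (6)(178ε₄) ∩ 𝔅_k(V) — ★w4-19200's E′ chart theorem ✓`isMinOn_regFibrePr_of_thm2_coercive142_at` with the BASED
# Theorem-2 binder at `W` derived from the knit's socket `hThm2` (✓`Prop7ChartWOfCov.thm2Based_member_of_thm2TorusAt`) and the displayed P-row `hcoW` — and (b) the competitor's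
# chart exponent at `W` from COV at `W` (✓`Prop7ChartWOfCov.exists_hermChart_of_cov_at` over ✓`cov_of_thm2TorusAt` at `B₃ := 1`).  So the EX knit's growth side now displays
# EXACTLY ONE row, `hcoW` = [Balaban1985Variational] (141)–(142) in the Landau chart at the critical background, in the letters of E′'s `hco`
# (✓`…PV3EChart.stub_PV3E_of_thm2_coercive142`) with R2-criticality replaced by the knit's E–L clause — ONE supplier text for E′ and EX (the α-P lane: ★p1 g12, ★w4-19200 g4
# F3–F6, routeR hands), and the Theorem-2 socket `hThm2` serves COV at `U₀`, the chart at `W`, and E′.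

Cell `ym3-torus`, width seat `ym-ust-19200-w2` (gen 4; EX knit lineage).  THEOREMS ONLY (0 `def`, 0 `sorry`).  CONDITIONAL: this file does NOT close the stub — the remaining
inputs are displayed hypotheses with named suppliers; `--supports stmt-QuantumFields-19200 --as helper`, count-neutral.  YM₃ on T³ is a ladder rung (R3), not the Clay problem;
nothing here claims the stub, the crux, d = 4 or the mass gap.

THE PRINT.  [Balaban1985Variational] p. 299: *«To see that U_k is a minimum we apply the whole procedure with the configuration U_k instead of U₀. We get a functional 𝒜(A′)
for which the critical configuration is equal to 0 … (141) … (142) A second order differential at A′ = 0 is given by the quadratic form above, and it is positive definite.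
Hence A′ = 0 is a minimum of the functional and this implies that U_k is a minimal configuration of the functional A(U)»*.  EX DISPLAY after this file (hypotheses, by
name): constants `B₀ C₄ a₃ α r M c₀ cB BH ef ε′`; N06 ×2 `norm_G`∕`norm_H₁`; P4 `prop4`; (45)–(46)-twˢ `h46tw` (+ `H` real); (WF) `hWe`∕`hWε`; `hMe`; (W137) `hw137`; `hBH0`;
(W47q)∕(W47R); `h102`∕`h129`; `h102L`∕`h129L`; `hrε`; (R-H₁) `hH₁R`; (R-𝒢) `h𝒢R`; (R-W) `hWR`; `hrα`∕`hr4`∕`hr16`; `hXtw‴` (XL: (112) ∘ (123)–(140) ∘ E–L); **(P) `hcoW`**;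
T2 `hThm2`.  REMOVED relative to v3.0ˢ: `aW haW`, `Tsl`, `hChartW`, `hLocW`.

WHAT IS PROVED (sorry-free, no definition).  ★★★ **`stubEX_of_chartPiecesTwS4`** — the REGISTERED text of `stub_existenceMinimalOrbit` (all `L > 1`, all `B₃ > 4`) from the
displayed rows: ✓`stubEX_of_chartPiecesTwS3` at the tautological slice, `aW` from the sockets' constants (`choose`), `hLocW` by definition, `hChartW` by (a) + (b) above and
the gauge invariance of (5) (✓`T4WilsonGaugeFlatDirection.wilsonAction_gaugeAct`), the competitor's axial copy lying in (6)(178ε₄) ∩ 𝔅_k(V) by [B8] Prop. 7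
(✓`regPr_emb15_of_in19`).

References: T. Bałaban, CMP 102 (1985) 277–309 [Balaban1985Variational]; CMP 99 (1985) 75–102 [Balaban1985RegularSpaces]; CMP 99 (1985) 389–434 [Balaban1985BackgroundPropagators];
CMP 98 (1985) 17–51 [Balaban1985Averaging] (loci in the theorem docstring).
-/

set_option autoImplicit false

noncomputable section

open scoped BigOperators Matrix.Norms.L2Operator Matrix

namespace Summit.QuantumFields.YangMills.Theorems.Prop7StubEXOfChartPiecesTwS5ECtrR

open NormedSpace
open Literature.MathematicalPhysics.QuantumFieldTheory.Balaban1983to89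
open Literature.MathematicalPhysics.QuantumFieldTheory.Balaban1983to89.T3ContinuumYM3Torus
open Literature.MathematicalPhysics.QuantumFieldTheory.Balaban1983to89.T3UnitLawDensityEML (ℰp)
open Literature.MathematicalPhysics.QuantumFieldTheory.Balaban1983to89.T3TiltDescent (descendTo)
open Literature.MathematicalPhysics.QuantumFieldTheory.Balaban1983to89.T3ConstrainedMinimiser (fibre)
open Literature.MathematicalPhysics.QuantumFieldTheory.Balaban1983to89.T3PrintedRegularMinimiser (RegPr regFibrePr)
open Literature.MathematicalPhysics.QuantumFieldTheory.Balaban1983to89.T3PrintedRegularOrbits (descTransf)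
open Literature.MathematicalPhysics.QuantumFieldTheory.Balaban1983to89.T3PrintedMinimiserExistence (regPr_mono)
open Literature.MathematicalPhysics.QuantumFieldTheory.Balaban1983to89.T3Thm1Carrier
open Literature.MathematicalPhysics.QuantumFieldTheory.Balaban1983to89.T3SectALandauChart (In19 emb15 CloseAvg eta bgUnits pert)
open BlockAveragingEMLLinearisedBackground (pertVar)
open B9SectCLatticeCarrier (Bond)
open B10Eq27TorusAxialLog (unitsField toUField pull)
open B11Eq115Space (NegSup NegSize Space115 JetSup)
open B11Eq111FrakG (nabla115)
open B11Eq98CurrentSlot (Jcur)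
open B11Prop3Model (Dfix)
open B13Contraction113 (QuadAnalytic)
open B8Thm2SetupTorus (Thm2SetupSUAt)
open B8Thm2TorusAt (Cond135T C136T C139T)
open B8Thm4TorusAt (torusLam)
open B8Eq138LandauZd (IsLandau138)
open B7Prop1Explicit renaming Site → LSite
open B7Prop2SpecialUnitary (specialUnitaryUnits)
open MatrixLog (mlog)
open Summit.QuantumFields.YangMills.Theorems.Prop7TPrint (nMax19 expHermField)
open Summit.QuantumFields.YangMills.Theorems.Prop7SPrint (AvgCondPrint AvgCondPrintS NormS IsLandauPrint IsLandauPrintS basePt RestrictedPrint IsAxialPrint)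
open Summit.QuantumFields.YangMills.Theorems.Prop7SectET3Transport (periodsT3 siteEquiv siteEquiv_shiftEquiv bgOfCfg bondEquiv)
open Summit.QuantumFields.YangMills.Theorems.Prop7SymAvgTwSym (dbarTwS QTwS CmapTwS Chart47T3twS)
open Summit.QuantumFields.YangMills.Theorems.Prop7Bound20SymLog (bound20_symLog_of_closeAvg)
open Summit.QuantumFields.YangMills.Theorems.Prop7ChartPiecesTwG (hChart_of_piecesTwG hXtw_of_split_etaG hXtw'_of_splitG)
open Summit.QuantumFields.YangMills.Theorems.Prop7StubEXOfChartPiecesTwS3SECtrR (stubEX_of_chartPiecesTwS3SECtrR)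
open Summit.QuantumFields.YangMills.Theorems.Prop7ChartWOfCov (exists_hermChart_of_cov_at)
open Summit.QuantumFields.YangMills.Theorems.Prop7SPrintThm2Dict (thm2Based_of_thm2SetupSUAt)
open Summit.QuantumFields.YangMills.Theorems.PV3EChart (isMinOn_regFibrePr_of_thm2_coercive142_at)
open Summit.QuantumFields.YangMills.Theorems.Prop7CovOfThm2 (cov_of_thm2SetupSUAt)
open B7Prop2Explicit (C0 c2' C0_pos c2'_pos)
open Literature.MathematicalPhysics.QuantumFieldTheory.Balaban1983to89.T3PrintedRegularOrbits (regPr_gaugeAct_iff)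
open Literature.MathematicalPhysics.QuantumFieldTheory.Balaban1983to89.T3PrintedRegularMinimiser (mem_regFibrePr_iff)
open Summit.QuantumFields.YangMills.Theorems.Prop7StubEXOfChartPiecesTwSR (bsym_isHermitian_trace_zero)
open Summit.QuantumFields.YangMills.Theorems.Prop7SolutionRealityRowS (hA₁R_of_letterReality)
open Summit.QuantumFields.YangMills.Theorems.Prop7DbarTwSymWindow (dbarTwS_window_of_regPr)
open Summit.QuantumFields.YangMills.Theorems.Prop7CmapTwSymInputs (chart47twS_of_regPr_eta)
open Summit.QuantumFields.YangMills.Theorems.Prop7StubEXOfChartPiecesTwL (windows_of_admissible three_le_memberL)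
open Summit.QuantumFields.YangMills.Theorems.Prop7StubEXOfChartPiecesTwS (windows_of_W)
open Summit.QuantumFields.YangMills.Theorems.Prop7SymSliceWitness (exists_normS_of_regPr_of_size)
open Summit.QuantumFields.YangMills.Theorems.Prop7DbarTwWindow (norm_smul_I_le_of_nMax19_lt)
open Summit.QuantumFields.YangMills.Theorems.Prop7B8Prop7Div (regPr_emb15_of_in19)
open Summit.QuantumFields.YangMills.Theorems.Prop7PV3CDELogChart (in19_expHermField_of_nMax19_lt)
open Summit.QuantumFields.YangMills.Theorems.Prop7ChartRealityRowS (hXtw''_of_reality)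

variable {L : ℕ}

/-! ## §1 The knit v3.2ˢ -/

/-- ★★★ **`stub_existenceMinimalOrbit`'s REGISTERED TEXT FROM THE PIECES OF THE CHART OF RECORD, v3.1ˢ — CHART_W PROVED, THE GROWTH SIDE = ONE ROW `hcoW` IN E′'s LETTERS.**
As ✓`stubEX_of_chartPiecesTwS3` (v3.0ˢ) but the opaque slice `Tsl`, the window `aW` and the rows CHART_W ∕ LOCMIN_W are DISCHARGED (tautological slice; `W = (e^{iX}U₀)^u` minimises
over (6)(178ε₄) ∩ 𝔅_k(V) by ★w4's ✓`isMinOn_regFibrePr_of_thm2_coercive142_at` with Theorem 2 BASED AT `W` from the socket `hThm2` and the displayed P-row `hcoW`; the competitor's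
chart exponent at `W` by COV at `W`, ✓`exists_hermChart_of_cov_at`), and the growth side displays the single row `hcoW`: (141)–(142) in the Landau chart at the critical
background — every Theorem-2 chart point `U₁W`, `U₁ = e^{iηA}`, (1.36)∕(1.38)∕(1.39) at radius `α ≤ c₇`, whose (1.29)-restricted `u`-image lies in (6)(e) ∩ 𝔅_k(V), has
`A(W) ≤ A(U₁W)`, for `W ∈ (6)(e) ∩ 𝔅_k(V)` E–L-critical (the knit's clause), `e ≤ e₇`.  PROVENANCE (for DEPMAP v3.19, ★★OWNER ACK 51): `hcoW` ≙ E′'s `hco` — the second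
hypothesis of ✓`PV3EChart.stub_PV3E_of_thm2_coercive142` — VERBATIM with [`IsCritR2 F n K hnK.le V U →` ↦ the E–L clause; letter `U` ↦ `W`]; NOT a new node: its supplier is
the α-P lane's single junction (ONE supplier text for E′ and EX).  CONDITIONAL — the stub is not closed.
[cite: Balaban1985Variational, Prop. 7 p.299, (141)-(142) p.299, Prop. 2 p.281, (5) p.278, (51) p.286, (47)–(49) p.285, (103) p.293, (111)–(112) p.294, Props 5–6 pp.294–296, (19)–(21) p.281; Balaban1985RegularSpaces, Thm 2 p.83, (1.35)–(1.39) pp.82–83; Balaban1985BackgroundPropagators, Thm 3.12 p.420, (3.124) p.420] -/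
theorem stubEX_of_chartPiecesTwS5ECtrR
    [hFL : ∀ F : T3Family, Fact (0 < (F.L : ℝ))] [hFη : ∀ (F : T3Family) (k : ℕ), Fact (0 < ((F.L : ℝ)⁻¹) ^ k)]
    -- the LIFT antecedent of the S7′ chain, OPAQUE `L`- and member-indexed predicate (like `Lan`; ★px14 (T1)(T2) design, EX namer REVIEW PASS 21:59:22Z; text of record fixed only at the display)
    (Lift : ∀ (L : ℕ) (i : Idx L), GaugeField (i.1.1.P i.1.2.2) 0 (Matrix.specialUnitaryGroup (Fin 2) ℂ) → Prop)
    -- the constants, member-uniform at each `L` (print: «absolute constants depending on d and L only»)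
    (B₀ C₄ a₃ α r M : ℕ → ℝ) (hB₀ : ∀ L, 1 < L → 0 < B₀ L) (hC₄ : ∀ L, 1 < L → 0 < C₄ L) (ha₃ : ∀ L, 1 < L → 0 < a₃ L)
    (hα : ∀ L, 1 < L → 0 < α L) (hr : ∀ L, 1 < L → 0 < r L) (hM : ∀ L, 1 < L → 0 < M L)
    -- the `L²` weights of the projected Landau condition (21)ˢ `IsLandauPrintS` (display place (d); print: `c₀ = η³`, `cB = 1`)
    (c₀ cB : ℕ → ℝ) [hc₀ : ∀ L : ℕ, Fact (0 < c₀ L)]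
    -- the curved letters `𝔊(U₀)`, `(δ/δA′)V`, `H₁(U₀)`, OPAQUE (the datum `B` is FIXED to `Bsym` on `Λ_k = PBond (P n) 0`)
    (𝒢f : ∀ (L : ℕ) (i : Idx L) (U₀ : GaugeField (i.1.1.P i.1.2.2) 0 (Matrix.specialUnitaryGroup (Fin 2) ℂ)),
      NegSize (i.1.1.L : ℝ) (((i.1.1.L : ℝ)⁻¹) ^ (i.1.2.2 - i.1.2.1)) (fun _ : Bond 3 (periodsT3 i.1.1 i.1.2.2) => i.1.2.2 - i.1.2.1) 3
          (Matrix (Fin 2) (Fin 2) ℂ) →L[ℂ]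
        Space115 (i.1.1.L : ℝ) (((i.1.1.L : ℝ)⁻¹) ^ (i.1.2.2 - i.1.2.1)) (fun _ : Bond 3 (periodsT3 i.1.1 i.1.2.2) => i.1.2.2 - i.1.2.1)
          (fun _ : Bond 3 (periodsT3 i.1.1 i.1.2.2) × Fin 3 => i.1.2.2 - i.1.2.1) (nabla115 (((i.1.1.L : ℝ)⁻¹) ^ (i.1.2.2 - i.1.2.1)) (bgOfCfg i.1.1 i.1.2.2 U₀)))
    (Wf : ∀ (L : ℕ) (i : Idx L) (U₀ : GaugeField (i.1.1.P i.1.2.2) 0 (Matrix.specialUnitaryGroup (Fin 2) ℂ)),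
      Space115 (i.1.1.L : ℝ) (((i.1.1.L : ℝ)⁻¹) ^ (i.1.2.2 - i.1.2.1)) (fun _ : Bond 3 (periodsT3 i.1.1 i.1.2.2) => i.1.2.2 - i.1.2.1)
          (fun _ : Bond 3 (periodsT3 i.1.1 i.1.2.2) × Fin 3 => i.1.2.2 - i.1.2.1) (nabla115 (((i.1.1.L : ℝ)⁻¹) ^ (i.1.2.2 - i.1.2.1)) (bgOfCfg i.1.1 i.1.2.2 U₀)) →
        NegSize (i.1.1.L : ℝ) (((i.1.1.L : ℝ)⁻¹) ^ (i.1.2.2 - i.1.2.1)) (fun _ : Bond 3 (periodsT3 i.1.1 i.1.2.2) => i.1.2.2 - i.1.2.1) 3 (Matrix (Fin 2) (Fin 2) ℂ))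
    (H₁f : ∀ (L : ℕ) (i : Idx L) (U₀ : GaugeField (i.1.1.P i.1.2.2) 0 (Matrix.specialUnitaryGroup (Fin 2) ℂ)),
      (PBond (i.1.1.P i.1.2.1) 0 → Matrix (Fin 2) (Fin 2) ℂ) →L[ℂ]
        Space115 (i.1.1.L : ℝ) (((i.1.1.L : ℝ)⁻¹) ^ (i.1.2.2 - i.1.2.1)) (fun _ : Bond 3 (periodsT3 i.1.1 i.1.2.2) => i.1.2.2 - i.1.2.1)
          (fun _ : Bond 3 (periodsT3 i.1.1 i.1.2.2) × Fin 3 => i.1.2.2 - i.1.2.1) (nabla115 (((i.1.1.L : ℝ)⁻¹) ^ (i.1.2.2 - i.1.2.1)) (bgOfCfg i.1.1 i.1.2.2 U₀)))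
    -- their displayed bounds (the `SectEDatum` fields at admissible backgrounds)
    (norm_G : ∀ (L : ℕ), 1 < L → ∀ (i : Idx L) (ρ : ℝ) (U₀ : GaugeField (i.1.1.P i.1.2.2) 0 (Matrix.specialUnitaryGroup (Fin 2) ℂ)),
      RegPr i.1.1 i.1.2.1 i.1.2.2 ρ U₀ → ρ ≤ α L → ∀ f, ‖𝒢f L i U₀ f‖ ≤ B₀ L * ‖f‖)
    (prop4 : ∀ (L : ℕ), 1 < L → ∀ (i : Idx L) (ρ : ℝ) (U₀ : GaugeField (i.1.1.P i.1.2.2) 0 (Matrix.specialUnitaryGroup (Fin 2) ℂ)),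
      RegPr i.1.1 i.1.2.1 i.1.2.2 ρ U₀ → ρ ≤ α L → QuadAnalytic (Wf L i U₀) (C₄ L) (a₃ L))
    (norm_H₁ : ∀ (L : ℕ), 1 < L → ∀ (i : Idx L) (ρ : ℝ) (U₀ : GaugeField (i.1.1.P i.1.2.2) 0 (Matrix.specialUnitaryGroup (Fin 2) ℂ)),
      RegPr i.1.1 i.1.2.1 i.1.2.2 ρ U₀ → ρ ≤ α L → ∀ b, ‖H₁f L i U₀ b‖ ≤ B₀ L * ‖b‖)
    -- (45)–(46)-twˢ AT ITS η-ORDER, against the chart of record `Q := QTwS U₀`, (45) in the projected form `IsLandauPrintS` (d): print's letter `H` — `QH = I`, `RD*H = 0` (45), `‖HY‖ ≤ B_H·η·‖Y‖` (46), η = L^{−(K−n)} (DISPLAYED; supplier of record: [Balaban1985BackgroundPropagators]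
    -- Thm 3.12 for `H` (3.126), (3.133) n = 0,1 ⊕ (2.61); T³ statement p607026 `normH₁_row_of_recordObligations` with `Hsel := Hk`; O(η) = pure scaling `H_route = η·H_print`)
    -- CURE (α) of the fourth located lettering defect (2026-08-28): the (45)–(46) operator is a NAMED top-level letter `Hf` (beside `𝒢f Wf H₁f`; supplier instantiates `Hf L i U₀ := H46 … U₀`)
    (Hf : ∀ (L : ℕ) (i : Idx L) (U₀ : GaugeField (i.1.1.P i.1.2.2) 0 (Matrix.specialUnitaryGroup (Fin 2) ℂ)),
      (PBond (i.1.1.P i.1.2.1) 0 → Matrix (Fin 2) (Fin 2) ℂ) →ₗ[ℂ] (PBond (i.1.1.P i.1.2.2) 0 → Matrix (Fin 2) (Fin 2) ℂ))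
    (BH : ℕ → ℝ)
    (h45 : ∀ (L : ℕ), 1 < L → ∀ (i : Idx L) (U₀ : GaugeField (i.1.1.P i.1.2.2) 0 (Matrix.specialUnitaryGroup (Fin 2) ℂ)), RegPr i.1.1 i.1.2.1 i.1.2.2 (α L) U₀ →
      ∀ Y, QTwS i.1.1 i.1.2.1 i.1.2.2 i.2.2.le U₀ (Hf L i U₀ Y) = Y)
    (h45L : ∀ (L : ℕ), 1 < L → ∀ (i : Idx L) (U₀ : GaugeField (i.1.1.P i.1.2.2) 0 (Matrix.specialUnitaryGroup (Fin 2) ℂ)), RegPr i.1.1 i.1.2.1 i.1.2.2 (α L) U₀ →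
      ∀ Y, IsLandauPrintS i.1.1 i.1.2.1 i.1.2.2 i.2.2.le (c₀ L) (cB L) U₀ (Hf L i U₀ Y))
    (h46₀ : ∀ (L : ℕ), 1 < L → ∀ (i : Idx L) (U₀ : GaugeField (i.1.1.P i.1.2.2) 0 (Matrix.specialUnitaryGroup (Fin 2) ℂ)), RegPr i.1.1 i.1.2.1 i.1.2.2 (α L) U₀ →
      ∀ Y, ‖Hf L i U₀ Y‖ ≤ BH L * eta i.1.1 i.1.2.1 i.1.2.2 * ‖Y‖)
    (hHfR : ∀ (L : ℕ), 1 < L → ∀ (i : Idx L) (U₀ : GaugeField (i.1.1.P i.1.2.2) 0 (Matrix.specialUnitaryGroup (Fin 2) ℂ)), RegPr i.1.1 i.1.2.1 i.1.2.2 (α L) U₀ →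
      ∀ Y, (∀ c, star (Y c) = -Y c ∧ (Y c).trace = 0) → ∀ b', star (Hf L i U₀ Y b') = -Hf L i U₀ Y b' ∧ (Hf L i U₀ Y b').trace = 0)
    -- the radius `e L` of the witness ∕ window theorems and the two L-only numerals (WF) of W3 ∕ W5 ∕ the witness (replace (WΣ))
    (ef : ℕ → ℝ) (hef : ∀ L, 1 < L → 0 < ef L)
    (hWe : ∀ L : ℕ, 1 < L → 10 ^ 9 * (L : ℝ) ^ 2 * ef L ≤ 1) (hWε : ∀ L : ℕ, 1 < L → 10 ^ 12 * (L : ℝ) ^ 3 * α L ≤ 1)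
    -- the size window linking (CH5EL-twˢ)'s size row to the witness ∕ window radius, and the regularity window of the chart point
    (hMe : ∀ L, 1 < L → M L * α L < ef L)
    (hw137 : ∀ L : ℕ, 1 < L → 10 ^ 7 * (L : ℝ) ^ 3 * (178 * (α L + ef L)) ≤ 1)
    -- (CH47-twˢ) IS A THEOREM here (✓`Prop7CmapTwSymInputs.chart47twS_of_regPr_eta`): Prop. 3 for the chart of record at `C₂ := 40M₀ˢ∕(e·η)²`, `M₀ˢ = 6(2e + 2700Lε₀)`, radius `η·ε′`; its two η-free windows are displayed
    (ε' : ℕ → ℝ) (hBH0 : ∀ L : ℕ, 1 < L → 0 ≤ BH L)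
    (hq47 : ∀ L : ℕ, 1 < L → 9 * (40 * (2 * (3 * (2 * ef L + 2700 * (L : ℝ) * α L))) / ef L ^ 2) * BH L * ε' L < 1)
    (hR6 : ∀ L : ℕ, 1 < L → 6 * ε' L ≤ ef L)
    -- (102)-twS «Q𝔊 = 0» and (129)-twS «QH₁ = id» for print's `Q(U₀) = η·(QTwS U₀ ∘ ι)`, read through the (115)-space dictionary `ι` (DISPLAYED, N06-class rows about the opaque letters)
    (h102 : ∀ (L : ℕ), 1 < L → ∀ (i : Idx L) (U₀ : GaugeField (i.1.1.P i.1.2.2) 0 (Matrix.specialUnitaryGroup (Fin 2) ℂ)), RegPr i.1.1 i.1.2.1 i.1.2.2 (α L) U₀ →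
      ∀ f : NegSize (i.1.1.L : ℝ) (((i.1.1.L : ℝ)⁻¹) ^ (i.1.2.2 - i.1.2.1)) (fun _ : Bond 3 (periodsT3 i.1.1 i.1.2.2) => i.1.2.2 - i.1.2.1) 3 (Matrix (Fin 2) (Fin 2) ℂ),
        QTwS i.1.1 i.1.2.1 i.1.2.2 i.2.2.le U₀ (fun b : PBond (i.1.1.P i.1.2.2) 0 => JetSup.equiv _ _ _ (𝒢f L i U₀ f) (bondEquiv i.1.1 i.1.2.2 b)) = 0)
    (h129 : ∀ (L : ℕ), 1 < L → ∀ (i : Idx L) (U₀ : GaugeField (i.1.1.P i.1.2.2) 0 (Matrix.specialUnitaryGroup (Fin 2) ℂ)), RegPr i.1.1 i.1.2.1 i.1.2.2 (α L) U₀ →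
      ∀ B : PBond (i.1.1.P i.1.2.1) 0 → Matrix (Fin 2) (Fin 2) ℂ,
        QTwS i.1.1 i.1.2.1 i.1.2.2 i.2.2.le U₀ (fun b : PBond (i.1.1.P i.1.2.2) 0 => JetSup.equiv _ _ _ (H₁f L i U₀ B) (bondEquiv i.1.1 i.1.2.2 b)) =
          fun c => (((eta i.1.1 i.1.2.1 i.1.2.2 : ℝ) : ℂ))⁻¹ • B c)
    -- (102)-L «R_S D*𝔊 = 0» and (129)-L «R_S D*H₁ = 0» ((3.124)-S) in the projected form `IsLandauPrintS` (d), read through `ι` (DISPLAYED; definitional for the S suppliers)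
    (h102L : ∀ (L : ℕ), 1 < L → ∀ (i : Idx L) (U₀ : GaugeField (i.1.1.P i.1.2.2) 0 (Matrix.specialUnitaryGroup (Fin 2) ℂ)), RegPr i.1.1 i.1.2.1 i.1.2.2 (α L) U₀ →
      ∀ f : NegSize (i.1.1.L : ℝ) (((i.1.1.L : ℝ)⁻¹) ^ (i.1.2.2 - i.1.2.1)) (fun _ : Bond 3 (periodsT3 i.1.1 i.1.2.2) => i.1.2.2 - i.1.2.1) 3 (Matrix (Fin 2) (Fin 2) ℂ),
        IsLandauPrintS i.1.1 i.1.2.1 i.1.2.2 i.2.2.le (c₀ L) (cB L) U₀ (fun b : PBond (i.1.1.P i.1.2.2) 0 => JetSup.equiv _ _ _ (𝒢f L i U₀ f) (bondEquiv i.1.1 i.1.2.2 b)))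
    (h129L : ∀ (L : ℕ), 1 < L → ∀ (i : Idx L) (U₀ : GaugeField (i.1.1.P i.1.2.2) 0 (Matrix.specialUnitaryGroup (Fin 2) ℂ)), RegPr i.1.1 i.1.2.1 i.1.2.2 (α L) U₀ →
      ∀ B : PBond (i.1.1.P i.1.2.1) 0 → Matrix (Fin 2) (Fin 2) ℂ,
        IsLandauPrintS i.1.1 i.1.2.1 i.1.2.2 i.2.2.le (c₀ L) (cB L) U₀ (fun b : PBond (i.1.1.P i.1.2.2) 0 => JetSup.equiv _ _ _ (H₁f L i U₀ B) (bondEquiv i.1.1 i.1.2.2 b)))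
    -- the chart-radius window (exponent scale): print's `A′ = A₁ + H₁B` of (103) lies in the `ε₃`-ball of Prop. 3-tw, `η(r + 2B₀α) ≤ ε₃`
    (hrε : ∀ L : ℕ, 1 < L → r L + 2 * B₀ L * α L ≤ ε' L)
    -- (R-H₁) the letter `H₁(U₀)` is REAL: Hermitian-traceless data ↦ Hermitian-traceless-valued (115)-fields (DISPLAYED, N06-class clause on the `norm_H₁` letter)
    (hH₁R : ∀ (L : ℕ), 1 < L → ∀ (i : Idx L) (U₀ : GaugeField (i.1.1.P i.1.2.2) 0 (Matrix.specialUnitaryGroup (Fin 2) ℂ)), RegPr i.1.1 i.1.2.1 i.1.2.2 (α L) U₀ →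
      ∀ B : PBond (i.1.1.P i.1.2.1) 0 → Matrix (Fin 2) (Fin 2) ℂ, (∀ c, (B c).IsHermitian ∧ (B c).trace = 0) →
        ∀ b' : PBond (i.1.1.P i.1.2.2) 0, (JetSup.equiv _ _ _ (H₁f L i U₀ B) (bondEquiv i.1.1 i.1.2.2 b')).IsHermitian ∧
          (JetSup.equiv _ _ _ (H₁f L i U₀ B) (bondEquiv i.1.1 i.1.2.2 b')).trace = 0)
    -- (R-𝒢) the letter `𝔊(U₀)` is REAL: Hermitian-traceless (−3)-data ↦ Hermitian-traceless (115)-fields (DISPLAYED, N06-class clause on the `norm_G` letter)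
    (h𝒢R : ∀ (L : ℕ), 1 < L → ∀ (i : Idx L) (U₀ : GaugeField (i.1.1.P i.1.2.2) 0 (Matrix.specialUnitaryGroup (Fin 2) ℂ)), RegPr i.1.1 i.1.2.1 i.1.2.2 (α L) U₀ →
      ∀ f : NegSize (i.1.1.L : ℝ) (((i.1.1.L : ℝ)⁻¹) ^ (i.1.2.2 - i.1.2.1)) (fun _ : Bond 3 (periodsT3 i.1.1 i.1.2.2) => i.1.2.2 - i.1.2.1) 3 (Matrix (Fin 2) (Fin 2) ℂ),
        (∀ b, (NegSup.equiv _ _ f b).IsHermitian ∧ (NegSup.equiv _ _ f b).trace = 0) →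
        ∀ b, (JetSup.equiv _ _ _ (𝒢f L i U₀ f) b).IsHermitian ∧ (JetSup.equiv _ _ _ (𝒢f L i U₀ f) b).trace = 0)
    -- (R-W) the letter `(δ∕δA′)V` is REAL on its ball: Hermitian-traceless (115)-fields ↦ Hermitian-traceless (−3)-data (DISPLAYED, P4-class clause on the `prop4` letter)
    (hWR : ∀ (L : ℕ), 1 < L → ∀ (i : Idx L) (U₀ : GaugeField (i.1.1.P i.1.2.2) 0 (Matrix.specialUnitaryGroup (Fin 2) ℂ)), RegPr i.1.1 i.1.2.1 i.1.2.2 (α L) U₀ →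
      ∀ A : Space115 (i.1.1.L : ℝ) (((i.1.1.L : ℝ)⁻¹) ^ (i.1.2.2 - i.1.2.1)) (fun _ : Bond 3 (periodsT3 i.1.1 i.1.2.2) => i.1.2.2 - i.1.2.1)
          (fun _ : Bond 3 (periodsT3 i.1.1 i.1.2.2) × Fin 3 => i.1.2.2 - i.1.2.1) (nabla115 (((i.1.1.L : ℝ)⁻¹) ^ (i.1.2.2 - i.1.2.1)) (bgOfCfg i.1.1 i.1.2.2 U₀)),
        ‖A‖ < a₃ L → (∀ b, (JetSup.equiv _ _ _ A b).IsHermitian ∧ (JetSup.equiv _ _ _ A b).trace = 0) →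
        ∀ b, (NegSup.equiv _ _ (Wf L i U₀ A) b).IsHermitian ∧ (NegSup.equiv _ _ (Wf L i U₀ A) b).trace = 0)
    -- the three `L`-only windows putting `ε₄ := r` in Prop. 6's uniqueness regime (118)∕(121)
    (hrα : ∀ L : ℕ, 1 < L → 2 * B₀ L * α L ≤ r L) (hr4 : ∀ L : ℕ, 1 < L → 4 * r L ≤ a₃ L) (hr16 : ∀ L : ℕ, 1 < L → 16 * B₀ L * C₄ L * r L ≤ 1)
    -- (CH5EL-twˢ)‴: (112) ∘ (123)–(140) ((19)-size) ∘ E–L (at the `NormS`-representatives) at print's `A′ = A₁ + H₁B` in the exponent scale `iη·(ι A₁ + ι(H₁B))`, for the REAL `H` of (45)–(46)-twˢ, chart remainder `Dfix (CmapTwS U₀)` (DISPLAYED, XL; no (20), (21), datum, NO REALITY — Prop. 5's «X is 𝔤-valued» is now proved)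
    (hXtw''' : ∀ (L : ℕ), 1 < L → ∀ (i : Idx L) (ε₁ : ℝ) (V : GaugeField (i.1.1.P i.1.2.1) 0 (Matrix.specialUnitaryGroup (Fin 2) ℂ))
      (U₀ : GaugeField (i.1.1.P i.1.2.2) 0 (Matrix.specialUnitaryGroup (Fin 2) ℂ)), 0 < ε₁ → PlaqSmall ε₁ V →
      RegPr i.1.1 i.1.2.1 i.1.2.2 ((L : ℝ) ^ 3 * (3 * (L : ℝ)) * ε₁) U₀ → CloseAvg i.1.1 i.1.2.1 i.1.2.2 i.2.2.le ((L : ℝ) ^ 3 * ε₁) V U₀ → Lift L i U₀ → (L : ℝ) ^ 3 * (3 * (L : ℝ)) * ε₁ ≤ α L →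
      ∀ A₁ : Space115 (i.1.1.L : ℝ) (((i.1.1.L : ℝ)⁻¹) ^ (i.1.2.2 - i.1.2.1)) (fun _ : Bond 3 (periodsT3 i.1.1 i.1.2.2) => i.1.2.2 - i.1.2.1)
          (fun _ : Bond 3 (periodsT3 i.1.1 i.1.2.2) × Fin 3 => i.1.2.2 - i.1.2.1) (nabla115 (((i.1.1.L : ℝ)⁻¹) ^ (i.1.2.2 - i.1.2.1)) (bgOfCfg i.1.1 i.1.2.2 U₀)),
        ‖A₁‖ < r L →
        A₁ + 𝒢f L i U₀ (Jcur (bgOfCfg i.1.1 i.1.2.2 U₀)) + 𝒢f L i U₀ (Wf L i U₀ (A₁ + H₁f L i U₀ (fun c : PBond (i.1.1.P i.1.2.1) 0 =>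
          (-Complex.I) • mlog (((V c : Matrix.specialUnitaryGroup (Fin 2) ℂ) : Matrix (Fin 2) (Fin 2) ℂ)
            * star ((descendTo i.1.1 ℰp i.1.2.1 i.1.2.2 i.2.2.le U₀ c : Matrix.specialUnitaryGroup (Fin 2) ℂ) : Matrix (Fin 2) (Fin 2) ℂ))))) = 0 →
        ∃ X : PBond (i.1.1.P i.1.2.2) 0 → Matrix (Fin 2) (Fin 2) ℂ,
          (((eta i.1.1 i.1.2.1 i.1.2.2 : ℝ) : ℂ) * Complex.I) • ((fun b : PBond (i.1.1.P i.1.2.2) 0 => JetSup.equiv _ _ _ A₁ (bondEquiv i.1.1 i.1.2.2 b))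
              + (fun b : PBond (i.1.1.P i.1.2.2) 0 => JetSup.equiv _ _ _ (H₁f L i U₀ (fun c : PBond (i.1.1.P i.1.2.1) 0 =>
          (-Complex.I) • mlog (((V c : Matrix.specialUnitaryGroup (Fin 2) ℂ) : Matrix (Fin 2) (Fin 2) ℂ)
            * star ((descendTo i.1.1 ℰp i.1.2.1 i.1.2.2 i.2.2.le U₀ c : Matrix.specialUnitaryGroup (Fin 2) ℂ) : Matrix (Fin 2) (Fin 2) ℂ)))) (bondEquiv i.1.1 i.1.2.2 b)))
            - Hf L i U₀ (Dfix (CmapTwS i.1.1 i.1.2.1 i.1.2.2 i.2.2.le U₀) (Hf L i U₀) (40 * (2 * (3 * (2 * ef L + 2700 * (i.1.1.L : ℝ) * α L))) / (ef L * eta i.1.1 i.1.2.1 i.1.2.2) ^ 2)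
              ((((eta i.1.1 i.1.2.1 i.1.2.2 : ℝ) : ℂ) * Complex.I) • ((fun b : PBond (i.1.1.P i.1.2.2) 0 => JetSup.equiv _ _ _ A₁ (bondEquiv i.1.1 i.1.2.2 b))
              + (fun b : PBond (i.1.1.P i.1.2.2) 0 => JetSup.equiv _ _ _ (H₁f L i U₀ (fun c : PBond (i.1.1.P i.1.2.1) 0 =>
          (-Complex.I) • mlog (((V c : Matrix.specialUnitaryGroup (Fin 2) ℂ) : Matrix (Fin 2) (Fin 2) ℂ)
            * star ((descendTo i.1.1 ℰp i.1.2.1 i.1.2.2 i.2.2.le U₀ c : Matrix.specialUnitaryGroup (Fin 2) ℂ) : Matrix (Fin 2) (Fin 2) ℂ)))) (bondEquiv i.1.1 i.1.2.2 b)))))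
            = (fun b => Complex.I • X b) ∧
          nMax19 i.1.1 i.1.2.1 i.1.2.2 U₀ X ≤ M L * ((L : ℝ) ^ 3 * (3 * (L : ℝ)) * ε₁) ∧
          (∀ u : GaugeTransf (i.1.1.P i.1.2.2) 0 (Matrix.specialUnitaryGroup (Fin 2) ℂ), NormS i.1.1 i.1.2.1 i.1.2.2 i.2.2.le U₀ X (expHermField X) u →
            GaugeField.gaugeAct u (emb15 U₀ (expHermField X)) ∈ fibre i.1.1 ℰp i.1.2.1 i.1.2.2 i.2.2.le V →
            ∀ γ : ℝ → GaugeField (i.1.1.P i.1.2.2) 0 (Matrix.specialUnitaryGroup (Fin 2) ℂ), γ 0 = GaugeField.gaugeAct u (emb15 U₀ (expHermField X)) →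
              (∀ t, γ t ∈ fibre i.1.1 ℰp i.1.2.1 i.1.2.2 i.2.2.le V) →
              (∀ b, DifferentiableAt ℝ (fun t => ((γ t b : Matrix.specialUnitaryGroup (Fin 2) ℂ) : Matrix (Fin 2) (Fin 2) ℂ)) 0) →
                deriv (fun t => wilsonAction4 (γ t)) 0 = 0))
    -- (P) THE ONE GROWTH ROW — [Balaban1985Variational] (141)–(142) IN THE LANDAU CHART AT THE CRITICAL BACKGROUND, in E′'s `hco` LETTERS (✓`…PV3EChart.stub_PV3E_of_thm2_coercive142`)
    -- with R2-criticality replaced by the knit's E–L clause (stationarity along bondwise-differentiable fibre curves): every Theorem-2 chart point `U₁W`, `U₁ = e^{iηA}`,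
    -- (1.36)∕(1.38)∕(1.39) at radius `α ≤ c₇`, whose (1.29)-restricted `u`-image lies in (6)(e) ∩ 𝔅_k(V), has `A(W) ≤ A(U₁W)` (DISPLAYED; the α-P lane's row)
    (hcoW : ∀ (L : ℕ), 1 < L → ∀ (B₁ : ℝ), 0 < B₁ → ∃ e₇ c₇ : ℝ, 0 < e₇ ∧ 0 < c₇ ∧
      ∀ (F : T3Family), F.L = L → ∀ (n K : ℕ) (hnK : n < K) (e α : ℝ) (V : GaugeField (F.P n) 0 (Matrix.specialUnitaryGroup (Fin 2) ℂ))
        (W U₁ : GaugeField (F.P K) 0 (Matrix.specialUnitaryGroup (Fin 2) ℂ)) (u : GaugeTransf (F.P K) 0 (Matrix.specialUnitaryGroup (Fin 2) ℂ))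
        (A : PBond (F.P K) 0 → Matrix (Fin 2) (Fin 2) ℂ),
        0 < e → e ≤ e₇ → 0 < α → α ≤ c₇ → W ∈ regFibrePr F n K hnK.le e V →
        (∀ γ : ℝ → GaugeField (F.P K) 0 (Matrix.specialUnitaryGroup (Fin 2) ℂ), γ 0 = W → (∀ t, γ t ∈ fibre F ℰp n K hnK.le V) →
          (∀ b, DifferentiableAt ℝ (fun t => ((γ t b : Matrix.specialUnitaryGroup (Fin 2) ℂ) : Matrix (Fin 2) (Fin 2) ℂ)) 0) →
            deriv (fun t => wilsonAction4 (γ t)) 0 = 0) →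
        RestrictedPrint F n K W u → (∀ b : PBond (F.P K) 0, IsSelfAdjoint (A b)) →
        (∀ b : PBond (F.P K) 0, ((U₁ b : Matrix.specialUnitaryGroup (Fin 2) ℂ) : Matrix (Fin 2) (Fin 2) ℂ) = exp (Complex.I • ((eta F n K) • A b))) →
        (∃ (β₀ B₂ : ℝ) (len : B7Prop1Explicit.Site (F.P K).d → ℝ),
          B8Thm2TorusAt.C136T (F.P K).L (K - n) (eta F n K) β₀ B₁ B₂ len α (pull (bgUnits F K W) (basePt F n K)) (pull A (basePt F n K))) →
        B8Eq138LandauZd.IsLandau138 (F.P K).L (K - n) (eta F n K) (Set.univ : Set (B7Prop1Explicit.Site (F.P K).d)) (B8Thm4TorusAt.torusLam (K - n))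
          (pull (bgUnits F K W) (basePt F n K)) (pull A (basePt F n K)) →
        B8Thm2TorusAt.C139T (F.P K).L (K - n) (eta F n K) B₁ α (pull (bgUnits F K W) (basePt F n K)) (pull A (basePt F n K)) →
        GaugeField.gaugeAct u (emb15 W U₁) ∈ regFibrePr F n K hnK.le e V →
          wilsonAction4 W ≤ wilsonAction4 (emb15 W U₁))
    -- (CTR) ★★OWNER RULING g28-№7 cure (ii-a): THE SYMMETRIC-CENTRE ROW `hSymCentre` (DISPLAYED; RADIUS-LETTER text of record 51a42dd370cd586d — ★px14 (T1′)'s `hS` all-`L` form with the centre radius `CS·ε₁`, `L³·3L ≤ CS`; supplier px20 «SYM-CENTRE»; passed through)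
    (hSymCentre : ∀ (L : ℕ), 1 < L → ∃ aS CS : ℝ, 0 < aS ∧ (L : ℝ) ^ 3 * (3 * (L : ℝ)) ≤ CS ∧ ∀ (i : Idx L) (ε₁ : ℝ), 0 < ε₁ → ε₁ ≤ aS →
        ∀ (V : GaugeField (i.1.1.P i.1.2.1) 0 (Matrix.specialUnitaryGroup (Fin 2) ℂ)) (U₀ : GaugeField (i.1.1.P i.1.2.2) 0 (Matrix.specialUnitaryGroup (Fin 2) ℂ)),
          PlaqSmall ε₁ V → RegPr i.1.1 i.1.2.1 i.1.2.2 ((L : ℝ) ^ 3 * (3 * (L : ℝ)) * ε₁) U₀ → U₀ ∈ fibre i.1.1 ℰp i.1.2.1 i.1.2.2 i.2.2.le V →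
          ∃ U₁ : GaugeField (i.1.1.P i.1.2.2) 0 (Matrix.specialUnitaryGroup (Fin 2) ℂ),
            U₁ ∈ fibre i.1.1 ℰp i.1.2.1 i.1.2.2 i.2.2.le V ∧ RegPr i.1.1 i.1.2.1 i.1.2.2 (CS * ε₁) U₁ ∧ Lift L i U₁)
    -- (T2) the [B8] Thm 2 sockets AT THE SETUP-TORUS OBJECTS (`Thm2SetupSUAt`, rider dropped), one `(B₁, c₁)` per `L` (v3.2ˢ currency — the weakest both consumers need)
    (hThm2S : ∀ (L : ℕ), 1 < L → ∃ B₁ c₁ : ℝ, 0 < B₁ ∧ 0 < c₁ ∧ ∀ (F : T3Family), F.L = L → ∀ (n K : ℕ), n < K →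
      ∃ (β₀ B₂ : ℝ) (len : B7Prop1Explicit.Site (F.P K).d → ℝ),
        Thm2SetupSUAt (F.P K) 2 (K - n) (eta F n K) β₀ B₁ B₂ c₁ len (fun _ => True)) :
    ∀ (L : ℕ), 1 < L → ∀ (B₃ : ℝ), 4 < B₃ → ∃ a₁' O₁ : ℝ, 0 < a₁' ∧ 1 ≤ O₁ ∧
    ∀ (F : T3Family), F.L = L → ∀ (n K : ℕ) (hnK : n < K) (ε₁ : ℝ), 0 < ε₁ →
      ∀ V : GaugeField (F.P n) 0 (Matrix.specialUnitaryGroup (Fin 2) ℂ), PlaqSmall ε₁ V →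
        ∀ U₀ : GaugeField (F.P K) 0 (Matrix.specialUnitaryGroup (Fin 2) ℂ), RegPr F n K ((L : ℝ) ^ 3 * B₃ * ε₁) U₀ → U₀ ∈ fibre F ℰp n K hnK.le V →
          ε₁ ≤ a₁' → ∃ U ∈ regFibrePr F n K hnK.le (O₁ * (L : ℝ) ^ 3 * B₃ * ε₁) V,
            IsMinOn (fun W : GaugeField (F.P K) 0 (Matrix.specialUnitaryGroup (Fin 2) ℂ) => wilsonAction4 W)
              (regFibrePr F n K hnK.le (O₁ * (L : ℝ) ^ 3 * B₃ * ε₁) V) U := by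
  classical
  -- the constants of the two sockets: Theorem 2's `(B₁, c₁)` per `L`, COV at `B₃ := 1` from them (`B₁′, c₁′`), and the P-row's `(e₇, c₇)` at `B₁`
  have hT2 := hThm2S
  choose! B₁ c₁ hB₁ hc₁ hT using hT2
  have hC : ∀ L : ℕ, 1 < L → ∃ B₁' c₁' : ℝ, 0 < B₁' ∧ 0 < c₁' ∧ _ := fun L hL => cov_of_thm2SetupSUAt (B₃ := 1) zero_le_one (hB₁ L hL) (hc₁ L hL) (hT L hL)
  choose! B₁' c₁' hB₁' hc₁' hCOV using hC
  choose! e₇ c₇ he₇ hc₇ hco using fun L hL => hcoW L hL (B₁ L) (hB₁ L hL)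
  -- the window `aW` at the critical background: all thresholds of the E′ chart theorem and of COV@W, divided by 178 (`e := 178ε₄`)
  refine stubEX_of_chartPiecesTwS3SECtrR Lift B₀ C₄ a₃ α r M
    (fun L => min (min (min (min (min (min (1 / (6 * C0 3 * 1)) (c2' 3 L / (4 * 1))) ((10 ^ 8 * (L : ℝ) ^ 3)⁻¹))
      (c₁ L / (2 + 2 * (2 * (14336 + 21 / 20 * (((5 * (L : ℝ)) ^ 2 / 4) * (10800 * (L : ℝ) + 1)))))))
      (c₇ L / (2 + 2 * (2 * (14336 + 21 / 20 * (((5 * (L : ℝ)) ^ 2 / 4) * (10800 * (L : ℝ) + 1))))))) (e₇ L)) (c₁' L / 2) / 178)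
    hB₀ hC₄ ha₃ hα hr hM ?_ c₀ cB 𝒢f Wf H₁f norm_G prop4 norm_H₁ Hf BH h45 h45L h46₀ hHfR ef hef hWe hWε hMe hw137 ε' hBH0 hq47 hR6 h102 h129 h102L h129L hrε hH₁R h𝒢R hWR
    hrα hr4 hr16 hXtw'''
    -- the TAUTOLOGICAL slice at the critical background: Hermitian-traceless directions along which `W` does not lose action (LOCMIN_W is then its definition;
    -- all content sits in CHART_W, proved below from the E′ chart theorem — consuming `hcoW` — and COV at `W`)
    (fun L i W => {D | (∀ b : PBond (i.1.1.P i.1.2.2) 0, (D b).IsHermitian ∧ Matrix.trace (D b) = 0) ∧ wilsonAction4 W ≤ wilsonAction4 (emb15 W (expHermField D))})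
    ?_ (fun L _ i ε₁ ε₄ V U₀ X u W _ _ _ _ _ _ _ _ _ _ _ _ _ _ _ D hD _ => hD.2) hSymCentre hThm2S
  · -- `0 < aW L`
    intro L hL
    have hL0 : (0 : ℝ) < (L : ℝ) := by exact_mod_cast (show 0 < L by omega)
    have h1 := C0_pos 3
    have h2 := c2'_pos 3 L (by omega)
    have h3 := hc₁ L hL
    have h4 := hc₇ L hL
    have h5 := he₇ L hL
    have h6 := hc₁' L hL
    positivity
  · -- CHART_W at the critical background `W = (e^{iX}U₀)^u`, from the E′ chart theorem (IsMinOn over (6)(178ε₄) ∩ 𝔅_k(V)) and COV at `W`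
    intro L hL i ε₁ ε₄ V U₀ X u W hε₁ hε₄4 hε₄W hlo hV hreg _hclose hXh hXε _h20 _h21 _hu hWdef hWfib hEL X' hX'ε hX'h h20' _h21'
    obtain ⟨⟨F, n, K⟩, hF, hnK⟩ := i
    simp only [Set.mem_setOf_eq] at hWdef hWfib hEL hreg hXε h20' hX'ε ⊢
    set CL : ℝ := 2 * (14336 + 21 / 20 * (((5 * (L : ℝ)) ^ 2 / 4) * (10800 * (L : ℝ) + 1))) with hCL_def
    have hL0 : (0 : ℝ) < (L : ℝ) := by exact_mod_cast (show 0 < L by omega)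
    have hFL : (F.L : ℝ) = (L : ℝ) := by exact_mod_cast hF
    have hCL0 : 0 ≤ CL := by positivity
    have hD : 0 < 2 + 2 * CL := by positivity
    -- the thresholds carried by `ε₄ ≤ aW L`, for `e := 178ε₄`
    set m : ℝ := min (min (min (min (min (min (1 / (6 * C0 3 * 1)) (c2' 3 L / (4 * 1))) ((10 ^ 8 * (L : ℝ) ^ 3)⁻¹)) (c₁ L / (2 + 2 * CL)))
      (c₇ L / (2 + 2 * CL))) (e₇ L)) (c₁' L / 2) with hm
    have hem : 178 * ε₄ ≤ m := by
      have : ε₄ ≤ m / 178 := hε₄W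
      linarith
    have heA : 178 * ε₄ ≤ min (1 / (6 * C0 3 * 1)) (c2' 3 L / (4 * 1)) :=
      hem.trans ((min_le_left _ _).trans ((min_le_left _ _).trans ((min_le_left _ _).trans ((min_le_left _ _).trans (min_le_left _ _)))))
    have he8 : 178 * ε₄ ≤ (10 ^ 8 * (F.L : ℝ) ^ 3)⁻¹ := by
      rw [hFL]; exact hem.trans ((min_le_left _ _).trans ((min_le_left _ _).trans ((min_le_left _ _).trans ((min_le_left _ _).trans (min_le_right _ _)))))
    have hec₁ : (2 + 2 * (2 * (14336 + 21 / 20 * (((5 * (F.L : ℝ)) ^ 2 / 4) * (10800 * (F.L : ℝ) + 1))))) * (178 * ε₄) ≤ c₁ L := by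
      rw [hFL, ← hCL_def]
      have h := hem.trans ((min_le_left _ _).trans ((min_le_left _ _).trans ((min_le_left _ _).trans (min_le_right _ _))))
      rwa [le_div_iff₀ hD, mul_comm] at h
    have hec₇ : (2 + 2 * (2 * (14336 + 21 / 20 * (((5 * (F.L : ℝ)) ^ 2 / 4) * (10800 * (F.L : ℝ) + 1))))) * (178 * ε₄) ≤ c₇ L := by
      rw [hFL, ← hCL_def]
      have h := hem.trans ((min_le_left _ _).trans ((min_le_left _ _).trans (min_le_right _ _)))
      rwa [le_div_iff₀ hD, mul_comm] at h
    have he₇' : 178 * ε₄ ≤ e₇ L := hem.trans ((min_le_left _ _).trans (min_le_right _ _))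
    have hec' : 178 * ε₄ + 178 * ε₄ ≤ c₁' L := by
      have h := hem.trans (min_le_right _ _)
      linarith
    -- the critical background and the competitor's axial copy lie in (6)(178ε₄) ∩ 𝔅_k(V) ([B8] Prop. 7 through (19))
    have h19 : In19 F n K ε₄ U₀ (expHermField X) X := in19_expHermField_of_nMax19_lt hXh hXε
    have h19' : In19 F n K ε₄ U₀ (expHermField X') X' := in19_expHermField_of_nMax19_lt hX'h hX'ε
    have hε₄0 : 0 < ε₄ := Prop7PV3CDELogChart.pos_of_in19 h19
    have he0 : (0 : ℝ) ≤ 178 * ε₄ := by positivity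
    have hRegW : RegPr F n K (178 * ε₄) W := by
      rw [hWdef]; exact (regPr_gaugeAct_iff F he0 u _).mpr (regPr_emb15_of_in19 (F := F) (n := n) (K := K) hε₄4 hlo hreg h19)
    have hWmem : W ∈ regFibrePr F n K hnK.le (178 * ε₄) V := (mem_regFibrePr_iff F).mpr ⟨hWfib, hRegW⟩
    obtain ⟨u', -, -, hW'fib⟩ := h20' (expHermField X') h19'.2.1
    have hRegW' : RegPr F n K (178 * ε₄) (GaugeField.gaugeAct u' (emb15 U₀ (expHermField X'))) :=
      (regPr_gaugeAct_iff F he0 u' _).mpr (regPr_emb15_of_in19 (F := F) (n := n) (K := K) hε₄4 hlo hreg h19')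
    have hW'mem : GaugeField.gaugeAct u' (emb15 U₀ (expHermField X')) ∈ regFibrePr F n K hnK.le (178 * ε₄) V :=
      (mem_regFibrePr_iff F).mpr ⟨hW'fib, hRegW'⟩
    -- `W` MINIMISES over (6)(178ε₄) ∩ 𝔅_k(V): the E′ chart theorem with Theorem 2 based at `W` (from the socket) and the P-row `hcoW` at `W`
    have hmin := isMinOn_regFibrePr_of_thm2_coercive142_at F hF hnK (c₇ := c₇ L) (Prop7StubEXOfChartPiecesTwS5.thm2Based_member_of_thm2SetupSUAt (hT L hL) F hF hnK) hWmem
      (fun α' u₁ U₁ A hα0 hα7 hru hA hexp h136 h138 h139 hmem =>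
        hco L hL F hF n K hnK (178 * ε₄) α' V W U₁ u₁ A (by positivity) he₇' hα0 hα7 hWmem hEL hru hA hexp h136 h138 h139 hmem)
      heA he8 hec₁ hec₇
    have a2 : wilsonAction4 (GaugeField.gaugeAct u' (emb15 U₀ (expHermField X'))) = wilsonAction4 (emb15 U₀ (expHermField X')) :=
      T4WilsonGaugeFlatDirection.wilsonAction_gaugeAct 1 u' _
    have hle : wilsonAction4 W ≤ wilsonAction4 (emb15 U₀ (expHermField X')) := by
      have h : wilsonAction4 W ≤ wilsonAction4 (GaugeField.gaugeAct u' (emb15 U₀ (expHermField X'))) := hmin hW'mem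
      exact h.trans_eq a2
    -- the chart exponent `D` of the competitor at `W`, from COV at `W`
    obtain ⟨D, hDh, hAD⟩ := exists_hermChart_of_cov_at F hF hnK (hCOV L hL) hWmem hW'mem heA hec'
    have hA' : wilsonAction4 (emb15 U₀ (expHermField X')) = wilsonAction4 (emb15 W (expHermField D)) := a2.symm.trans hAD
    have hmemD : (∀ b : PBond (F.P K) 0, (D b).IsHermitian ∧ Matrix.trace (D b) = 0) ∧ wilsonAction4 W ≤ wilsonAction4 (emb15 W (expHermField D)) :=
      ⟨hDh, hle.trans_eq hA'⟩
    exact ⟨D, hmemD, hDh, hA'⟩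

end Summit.QuantumFields.YangMills.Theorems.Prop7StubEXOfChartPiecesTwS5ECtrR

end
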